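import Summits.AnomalousDissipation.AnomalousDissipation.Theorems.SolenoidalFractalHomogenisationLagrangianStepVmodSSReduce
import HarnessLib

/-!
# K1L_D (stmt-AnomalousDissipation-27980): (V_mod) flat stage, block (ss) — SCALAR TOOLS for the regime lemmas in the final currency, part 1
(helper; `--supports 27980 --as helper`; prover ad-sawtooth-k1loc-p1 g15.)

* `norm_latticeVec_sq_eq` / `norm_latticeVec_eq_sqrt` — `‖latticeVec ℓ‖² = |ℓ|²` (the tiny facts `e^{−x} ≤ 1/x`, `b ≤ b^e` are
  `Literature…Tao2016.exp_neg_le_inv` / `…B5SupHolderTorus.le_rpow_self_of_le_one`; re-derived inline where used, not imported);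
* `high_label_bounds` — a high label (`g₀·n < ‖ℓ‖⌈K/ν⌉`, `ν ≤ 1`) has `nν ≤ ((K+1)/g₀)‖ℓ‖` and
  `RP ≥ 8π²(lo/Λ)·(M·Wp)·c·g₀²/(K+1)²` (`R = 8π²·loT·|ℓ|²`, `P = M·Wp/ν`).
`sorry`-free; NOT a proof of (ss), of the stub, of K1L_D or of AD; rung F-D1.A0.
-/

set_option linter.dupNamespace false

noncomputable section

namespace Summit.AnomalousDissipation.AnomalousDissipation.Theorems.SolenoidalFractalHomogenisation.LagrangianStep.VmodGen

open Literature.Analysis Literature.Analysis.FunctionSpaces Literature.Analysis.FunctionSpaces.Torus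
open Literature.Analysis.FluidPDE Literature.Analysis.FluidPDE.Torus
open Summit.AnomalousDissipation.AnomalousDissipation.Theorems.SolenoidalFractalHomogenisation.LagrangianStep.VmodFlat (loT)

/-- `‖latticeVec ℓ‖² = |ℓ|²`. -/
theorem norm_latticeVec_sq_eq (ℓ : Fin 3 → ℤ) : ‖Torus.latticeVec ℓ‖ ^ 2 = Torus.freqNormSq ℓ := by
  rw [EuclideanSpace.norm_sq_eq, Torus.freqNormSq]
  refine Finset.sum_congr rfl fun i _ => ?_
  rw [Torus.latticeVec_apply, Real.norm_eq_abs, sq_abs]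

/-- `‖latticeVec ℓ‖ = √|ℓ|²`. -/
theorem norm_latticeVec_eq_sqrt (ℓ : Fin 3 → ℤ) : ‖Torus.latticeVec ℓ‖ = Real.sqrt (Torus.freqNormSq ℓ) := by
  rw [← norm_latticeVec_sq_eq, Real.sqrt_sq (norm_nonneg _)]

/-- **High labels**: if `g₀·n < ‖ℓ‖·⌈K/ν⌉` (`0 < g₀`, `0 < ν ≤ 1`, `0 ≤ K`), then `n·ν ≤ ((K+1)/g₀)·‖ℓ‖` and
`8π²(lo/Λ)(M·Wp)·c·g₀²/(K+1)² ≤ R·P` (`R = 8π²·loT·|ℓ|²`, `P = M·Wp/ν`; `lo/Λ, M·Wp, c ≥ 0`). -/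
theorem high_label_bounds {lo Λ c M Wp ν K g₀ : ℝ} {n : ℕ} (hloΛ : 0 ≤ lo / Λ) (hc : 0 ≤ c) (hMW : 0 ≤ M * Wp)
    (hν : 0 < ν) (hν1 : ν ≤ 1) (hK : 0 ≤ K) (hn : 1 ≤ n) (hg₀ : 0 < g₀)
    {ℓ : Fin 3 → ℤ} (hhigh : g₀ * n < ‖Torus.latticeVec ℓ‖ * (⌈K / ν⌉₊ : ℝ)) :
    (n : ℝ) * ν ≤ ((K + 1) / g₀) * ‖Torus.latticeVec ℓ‖ ∧
      8 * Real.pi ^ 2 * (lo / Λ) * (M * Wp) * c * g₀ ^ 2 / (K + 1) ^ 2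
        ≤ 8 * Real.pi ^ 2 * loT lo Λ c ν n * Torus.freqNormSq ℓ * (M * Wp / ν) := by
  have hn0 : (0:ℝ) < n := by exact_mod_cast (show 0 < n from hn)
  have hceil : (⌈K / ν⌉₊ : ℝ) ≤ (K + 1) / ν := by
    have h1 := (Nat.ceil_lt_add_one (div_nonneg hK hν.le : 0 ≤ K / ν)).le
    have h2 : K / ν + 1 ≤ (K + 1) / ν := by
      rw [add_div]; have : (1:ℝ) ≤ 1 / ν := by rw [le_div_iff₀ hν]; linarith
      linarith
    exact h1.trans h2
  have hL0 := norm_nonneg (Torus.latticeVec ℓ)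
  -- `g₀·n·ν ≤ (K+1)·‖ℓ‖`
  have hkey : g₀ * n * ν ≤ (K + 1) * ‖Torus.latticeVec ℓ‖ := by
    have h1 : g₀ * n ≤ ‖Torus.latticeVec ℓ‖ * ((K + 1) / ν) := hhigh.le.trans (mul_le_mul_of_nonneg_left hceil hL0)
    have h2 := mul_le_mul_of_nonneg_right h1 hν.le
    calc g₀ * n * ν ≤ ‖Torus.latticeVec ℓ‖ * ((K + 1) / ν) * ν := h2
      _ = (K + 1) * ‖Torus.latticeVec ℓ‖ := by field_simp
  refine ⟨?_, ?_⟩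
  · rw [div_mul_eq_mul_div, le_div_iff₀ hg₀]; linarith
  · -- squares: `g₀²n²ν² ≤ (K+1)²|ℓ|²`
    have hK1 : 0 < K + 1 := by linarith
    have hsq : (g₀ * n * ν) ^ 2 ≤ ((K + 1) * ‖Torus.latticeVec ℓ‖) ^ 2 := pow_le_pow_left₀ (by positivity) hkey 2
    have hsq' : g₀ ^ 2 * ((n:ℝ) ^ 2 * ν ^ 2) ≤ Torus.freqNormSq ℓ * (K + 1) ^ 2 := by
      rw [← norm_latticeVec_sq_eq]; nlinarith [hsq]
    unfold loT
    -- compare with the `c/ν` part of `ν + c/ν`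
    have hq0 := Torus.freqNormSq_nonneg ℓ
    have h1 : 8 * Real.pi ^ 2 * ((1 / (n:ℝ) ^ 2) * ((c / ν) * (lo / Λ))) * Torus.freqNormSq ℓ * (M * Wp / ν)
        ≤ 8 * Real.pi ^ 2 * ((1 / (n:ℝ) ^ 2) * ((ν + c / ν) * (lo / Λ))) * Torus.freqNormSq ℓ * (M * Wp / ν) := by
      have : c / ν ≤ ν + c / ν := by linarith
      have h3 : (1 / (n:ℝ) ^ 2) * ((c / ν) * (lo / Λ)) ≤ (1 / (n:ℝ) ^ 2) * ((ν + c / ν) * (lo / Λ)) :=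
        mul_le_mul_of_nonneg_left (mul_le_mul_of_nonneg_right this hloΛ) (by positivity)
      exact mul_le_mul_of_nonneg_right (mul_le_mul_of_nonneg_right (mul_le_mul_of_nonneg_left h3 (by positivity)) hq0)
        (by positivity)
    refine le_trans ?_ h1
    have e1 : 8 * Real.pi ^ 2 * ((1 / (n:ℝ) ^ 2) * ((c / ν) * (lo / Λ))) * Torus.freqNormSq ℓ * (M * Wp / ν)
        = 8 * Real.pi ^ 2 * (lo / Λ) * (M * Wp) * c * (Torus.freqNormSq ℓ / ((n:ℝ) ^ 2 * ν ^ 2)) := by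
      field_simp
    rw [e1]
    have h2 : g₀ ^ 2 / (K + 1) ^ 2 ≤ Torus.freqNormSq ℓ / ((n:ℝ) ^ 2 * ν ^ 2) := by
      rw [div_le_div_iff₀ (by positivity) (by positivity)]; exact hsq'
    have := mul_le_mul_of_nonneg_left h2 (by positivity : 0 ≤ 8 * Real.pi ^ 2 * (lo / Λ) * (M * Wp) * c)
    calc 8 * Real.pi ^ 2 * (lo / Λ) * (M * Wp) * c * g₀ ^ 2 / (K + 1) ^ 2
        = 8 * Real.pi ^ 2 * (lo / Λ) * (M * Wp) * c * (g₀ ^ 2 / (K + 1) ^ 2) := by ring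
      _ ≤ _ := this


end Summit.AnomalousDissipation.AnomalousDissipation.Theorems.SolenoidalFractalHomogenisation.LagrangianStep.VmodGen

end
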